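import Summits.CriticalPhenomena.PercolationContinuityZ3.Theorems.PercNearOneGluingNoHeavyLowerTailQ44bPairTransplant
import Summits.CriticalPhenomena.PercolationContinuityZ3.Theorems.PercNearOneGluingNoHeavyLowerTailConditionalThreePointAGSet
import HarnessLib

/-!
# `Q44b` is concave along the pencil of the edge `{a,c}`: the `z = c` case of `ND_a` as a four-point inequality

Support file for crux `stmt-CriticalPhenomena-4575` (master-family programme, the `Q44b` / `ND_a` line), seat `prim-l12-p6`
gen 7; memo `run/shared/lean/prim/prim-l12/FROM-prim-l12-p6-g7-Q44B-PENCIL-CONCAVITY.md` §3c.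

Bond percolation `μ = prodBernoulli w` on a finite vertex type, vertices `a b c y`, `P(π)` the probability of the partition
`π` of `{a,b,c,y}` induced by the open clusters.  When the vertex glued into `a` along a pencil is the terminal `c`, the
5-point concavity condition `ND_a` of the reduction (`Q44b.NDa`, file `…Q44bPencilReduction`) collapses to the 4-point inequality

  `pencilAtC`:  `[P(ab|cy)+P(ab|c|y)]·P(a|by|c) + P(ab|c|y)·P(ay|b|c)`
              `≤ P(a|bcy)·P(ay|b|c) + [P(ab|cy)+P(ab|c|y)]·P(ay|bc) + P(ay|bc)·P(∅) + P(aby|c)·P(∅) + P(ab|c|y)·P(a|bcy)`,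

which this file proves for every finite weighted graph, termwise, from
* `pairTransplant` (`P(ab|cy)·P(a|by|c) ≤ P(ab|c|y)·P(a|bcy)`), and
* `condAD3`: `P(ab|c|y)·[P(a|by|c) + P(ay|b|c)] ≤ P(a|b|c|y)·P(aby|c)` — the Ahlswede–Daykin three-point rectangle for
  `(a,b,y)` conditioned on the isolated set `{c}`, i.e. two of the three products of the tree's conditional Aas–Gladkov
  inequality `CutVertexMinors.condAG_isolatedSet_lab` (Gladkov–Zimin Cor. 3.5 with `T = {c}`).
Theorems only; standard axioms.
-/

namespace Summit.CriticalPhenomena.PercolationContinuityZ3.Theorems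

namespace Q44bExchange

open MeasureTheory Set
open Literature.Probability.LatticeModels (prodBernoulli)
open Literature.Probability.Percolation
open CutVertexMinors M3Lab

variable {V : Type*}

/-- Membership in `{x ↔ y}` (local restatement by `Iff.rfl`, used inside `simp` sets). -/
private theorem mem_openConn_iff_reach (ω : BondConfig V) (x y : V) :
    ω ∈ (openConn x y : Set (BondConfig V)) ↔ (openGraph ω).Reachable x y := Iff.rfl

/-- The isolation event `{a,b,y} ↮ {c}` as an intersection of complements. [folklore] -/
theorem isolated_c_eq (a b c y : V) :
    {ω : BondConfig V | ∀ s ∈ ({a, b, y} : Set V), ∀ t ∈ ({c} : Set V), ¬ (openGraph ω).Reachable s t} =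
      (openConn a c)ᶜ ∩ (openConn b c)ᶜ ∩ (openConn y c)ᶜ := by
  ext ω
  simp only [mem_setOf_eq, mem_insert_iff, mem_singleton_iff, forall_eq_or_imp, forall_eq, mem_inter_iff,
    mem_compl_iff, mem_openConn_iff_reach]
  tauto

/-- The label events of `lab3 a b y` as connection events. [folklore] -/
theorem lab3_eq_ab_iff (a b y : V) (ω : BondConfig V) :
    lab3 a b y ω = M3Lab.ab ↔ (openGraph ω).Reachable a b ∧ ¬ (openGraph ω).Reachable a y := by
  unfold lab3; split_ifs <;> simp_all

/-- The label events of `lab3 a b y` as connection events. [folklore] -/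
theorem lab3_eq_ac_iff (a b y : V) (ω : BondConfig V) :
    lab3 a b y ω = M3Lab.ac ↔ ¬ (openGraph ω).Reachable a b ∧ (openGraph ω).Reachable a y := by
  unfold lab3; split_ifs <;> simp_all

/-- The label events of `lab3 a b y` as connection events. [folklore] -/
theorem lab3_eq_bc_iff (a b y : V) (ω : BondConfig V) :
    lab3 a b y ω = M3Lab.bc ↔
      ¬ (openGraph ω).Reachable a b ∧ ¬ (openGraph ω).Reachable a y ∧ (openGraph ω).Reachable b y := by
  unfold lab3; split_ifs <;> simp_all

/-- The label events of `lab3 a b y` as connection events. [folklore] -/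
theorem lab3_eq_top_iff (a b y : V) (ω : BondConfig V) :
    lab3 a b y ω = M3Lab.top ↔ (openGraph ω).Reachable a b ∧ (openGraph ω).Reachable a y := by
  unfold lab3; split_ifs <;> simp_all

/-- The label events of `lab3 a b y` as connection events. [folklore] -/
theorem lab3_eq_bot_iff (a b y : V) (ω : BondConfig V) :
    lab3 a b y ω = M3Lab.bot ↔
      ¬ (openGraph ω).Reachable a b ∧ ¬ (openGraph ω).Reachable a y ∧ ¬ (openGraph ω).Reachable b y := by
  unfold lab3; split_ifs <;> simp_all

variable [Fintype V]

/-- **Conditional AD3** (`T = {c}` isolated): `P(ab|c|y) · [P(a|by|c) + P(ay|b|c)] ≤ P(a|b|c|y) · P(aby|c)`, the cells written inside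
`D = {a≁c} ∩ {b≁c} ∩ {y≁c}`.  Two of the three products of `condAG_isolatedSet_lab`.
[cite: GladkovZimin2024HK, Cor. 3.5 (conditional three-point inequality) — corollary] -/
theorem condAD3 (w : Sym2 V → unitInterval) (a b c y : V) :
    (prodBernoulli w).real ((openConn a c)ᶜ ∩ (openConn b c)ᶜ ∩ (openConn y c)ᶜ ∩ (openConn a b ∩ (openConn a y)ᶜ)) *
        ((prodBernoulli w).real ((openConn a c)ᶜ ∩ (openConn b c)ᶜ ∩ (openConn y c)ᶜ ∩
            ((openConn a b)ᶜ ∩ (openConn a y)ᶜ ∩ openConn b y)) +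
          (prodBernoulli w).real ((openConn a c)ᶜ ∩ (openConn b c)ᶜ ∩ (openConn y c)ᶜ ∩
            ((openConn a b)ᶜ ∩ openConn a y))) ≤
      (prodBernoulli w).real ((openConn a c)ᶜ ∩ (openConn b c)ᶜ ∩ (openConn y c)ᶜ ∩
          ((openConn a b)ᶜ ∩ (openConn a y)ᶜ ∩ (openConn b y)ᶜ)) *
        (prodBernoulli w).real ((openConn a c)ᶜ ∩ (openConn b c)ᶜ ∩ (openConn y c)ᶜ ∩ (openConn a b ∩ openConn a y)) := by
  classical
  have key := condAG_isolatedSet_lab w a b y ({c} : Set V)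
  have hab : {ω : BondConfig V | lab3 a b y ω = M3Lab.ab} = openConn a b ∩ (openConn a y)ᶜ := by
    ext ω; simp only [mem_setOf_eq, lab3_eq_ab_iff, mem_inter_iff, mem_compl_iff, mem_openConn_iff_reach]
  have hac : {ω : BondConfig V | lab3 a b y ω = M3Lab.ac} = (openConn a b)ᶜ ∩ openConn a y := by
    ext ω; simp only [mem_setOf_eq, lab3_eq_ac_iff, mem_inter_iff, mem_compl_iff, mem_openConn_iff_reach]
  have hbc : {ω : BondConfig V | lab3 a b y ω = M3Lab.bc} = (openConn a b)ᶜ ∩ (openConn a y)ᶜ ∩ openConn b y := by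
    ext ω; simp only [mem_setOf_eq, lab3_eq_bc_iff, mem_inter_iff, mem_compl_iff, mem_openConn_iff_reach, and_assoc]
  have htop : {ω : BondConfig V | lab3 a b y ω = M3Lab.top} = openConn a b ∩ openConn a y := by
    ext ω; simp only [mem_setOf_eq, lab3_eq_top_iff, mem_inter_iff, mem_openConn_iff_reach]
  have hbot : {ω : BondConfig V | lab3 a b y ω = M3Lab.bot} =
      (openConn a b)ᶜ ∩ (openConn a y)ᶜ ∩ (openConn b y)ᶜ := by
    ext ω; simp only [mem_setOf_eq, lab3_eq_bot_iff, mem_inter_iff, mem_compl_iff, mem_openConn_iff_reach, and_assoc]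
  rw [isolated_c_eq, hab, hac, hbc, htop, hbot] at key
  have hnn : 0 ≤ (prodBernoulli w).real ((openConn a c)ᶜ ∩ (openConn b c)ᶜ ∩ (openConn y c)ᶜ ∩
      ((openConn a b)ᶜ ∩ openConn a y)) *
      (prodBernoulli w).real ((openConn a c)ᶜ ∩ (openConn b c)ᶜ ∩ (openConn y c)ᶜ ∩
      ((openConn a b)ᶜ ∩ (openConn a y)ᶜ ∩ openConn b y)) := mul_nonneg measureReal_nonneg measureReal_nonneg
  nlinarith [key, hnn]

omit [Fintype V] in
/-- Two spellings of the cell `ab|c|y`. [folklore] -/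
theorem cell_ab_c_y_eq (a b c y : V) :
    ((openConn a c)ᶜ ∩ (openConn b c)ᶜ ∩ (openConn y c)ᶜ ∩ (openConn a b ∩ (openConn a y)ᶜ) : Set (BondConfig V)) =
      (openConn a c)ᶜ ∩ (openConn a y)ᶜ ∩ openConn a b ∩ (openConn c y)ᶜ := by
  ext ω
  simp only [mem_inter_iff, mem_compl_iff, mem_openConn_iff_reach]
  constructor
  · rintro ⟨⟨⟨h1, h2⟩, h3⟩, h4, h5⟩
    exact ⟨⟨⟨h1, h5⟩, h4⟩, fun h => h3 h.symm⟩
  · rintro ⟨⟨⟨h1, h2⟩, h3⟩, h4⟩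
    exact ⟨⟨⟨h1, fun h => h1 (h3.trans h)⟩, fun h => h4 h.symm⟩, h3, h2⟩

omit [Fintype V] in
/-- Two spellings of the cell `a|by|c`. [folklore] -/
theorem cell_a_by_c_eq (a b c y : V) :
    ((openConn a c)ᶜ ∩ (openConn b c)ᶜ ∩ (openConn y c)ᶜ ∩ ((openConn a b)ᶜ ∩ (openConn a y)ᶜ ∩ openConn b y) :
        Set (BondConfig V)) =
      (openConn a b)ᶜ ∩ (openConn a c)ᶜ ∩ (openConn a y)ᶜ ∩ openConn b y ∩ (openConn c y)ᶜ := by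
  ext ω
  simp only [mem_inter_iff, mem_compl_iff, mem_openConn_iff_reach]
  constructor
  · rintro ⟨⟨⟨h1, h2⟩, h3⟩, ⟨h4, h5⟩, h6⟩
    exact ⟨⟨⟨⟨h4, h1⟩, h5⟩, h6⟩, fun h => h3 h.symm⟩
  · rintro ⟨⟨⟨⟨h1, h2⟩, h3⟩, h4⟩, h5⟩
    exact ⟨⟨⟨h2, fun h => h5 (h4.symm.trans h).symm⟩, fun h => h5 h.symm⟩, ⟨h1, h3⟩, h4⟩

/-- **`Q44b` is concave along the `{a,c}` pencil** (the `z = c` case of `ND_a`, as a four-point inequality; memo §3c):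
`[P(ab|cy)+P(ab|c|y)]·P(a|by|c) + P(ab|c|y)·P(ay|b|c) ≤ P(a|bcy)·P(ay|b|c) + [P(ab|cy)+P(ab|c|y)]·P(ay|bc) + P(ay|bc)·P(∅) + P(aby|c)·P(∅) + P(ab|c|y)·P(a|bcy)`.
Termwise from `pairTransplant` and `condAD3`. [this work] -/
theorem pencilAtC (w : Sym2 V → unitInterval) (a b c y : V) :
    ((prodBernoulli w).real ((openConn a c)ᶜ ∩ (openConn a y)ᶜ ∩ (openConn a b ∩ openConn c y)) +
          (prodBernoulli w).real ((openConn a c)ᶜ ∩ (openConn a y)ᶜ ∩ openConn a b ∩ (openConn c y)ᶜ)) *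
        (prodBernoulli w).real ((openConn a b)ᶜ ∩ (openConn a c)ᶜ ∩ (openConn a y)ᶜ ∩ openConn b y ∩ (openConn c y)ᶜ) +
      (prodBernoulli w).real ((openConn a c)ᶜ ∩ (openConn a y)ᶜ ∩ openConn a b ∩ (openConn c y)ᶜ) *
        (prodBernoulli w).real ((openConn a c)ᶜ ∩ (openConn b c)ᶜ ∩ (openConn y c)ᶜ ∩ ((openConn a b)ᶜ ∩ openConn a y)) ≤
    (prodBernoulli w).real ((openConn a b)ᶜ ∩ (openConn a c)ᶜ ∩ (openConn a y)ᶜ ∩ (openConn b y ∩ openConn c y)) *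
        (prodBernoulli w).real ((openConn a c)ᶜ ∩ (openConn b c)ᶜ ∩ (openConn y c)ᶜ ∩ ((openConn a b)ᶜ ∩ openConn a y)) +
      ((prodBernoulli w).real ((openConn a c)ᶜ ∩ (openConn a y)ᶜ ∩ (openConn a b ∩ openConn c y)) +
          (prodBernoulli w).real ((openConn a c)ᶜ ∩ (openConn a y)ᶜ ∩ openConn a b ∩ (openConn c y)ᶜ)) *
        (prodBernoulli w).real ((openConn a b)ᶜ ∩ (openConn a c)ᶜ ∩ openConn a y ∩ openConn b c) +
      (prodBernoulli w).real ((openConn a b)ᶜ ∩ (openConn a c)ᶜ ∩ openConn a y ∩ openConn b c) *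
        (prodBernoulli w).real ((openConn a c)ᶜ ∩ (openConn b c)ᶜ ∩ (openConn y c)ᶜ ∩
          ((openConn a b)ᶜ ∩ (openConn a y)ᶜ ∩ (openConn b y)ᶜ)) +
      (prodBernoulli w).real ((openConn a c)ᶜ ∩ (openConn b c)ᶜ ∩ (openConn y c)ᶜ ∩ (openConn a b ∩ openConn a y)) *
        (prodBernoulli w).real ((openConn a c)ᶜ ∩ (openConn b c)ᶜ ∩ (openConn y c)ᶜ ∩
          ((openConn a b)ᶜ ∩ (openConn a y)ᶜ ∩ (openConn b y)ᶜ)) +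
      (prodBernoulli w).real ((openConn a c)ᶜ ∩ (openConn a y)ᶜ ∩ openConn a b ∩ (openConn c y)ᶜ) *
        (prodBernoulli w).real ((openConn a b)ᶜ ∩ (openConn a c)ᶜ ∩ (openConn a y)ᶜ ∩ (openConn b y ∩ openConn c y)) := by
  have h1 := pairTransplant w a b c y
  have h2 := condAD3 w a b c y
  rw [cell_ab_c_y_eq, cell_a_by_c_eq] at h2
  have n1 : 0 ≤ (prodBernoulli w).real ((openConn a c)ᶜ ∩ (openConn a y)ᶜ ∩ (openConn a b ∩ openConn c y)) :=
    measureReal_nonneg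
  have n2 : 0 ≤ (prodBernoulli w).real ((openConn a c)ᶜ ∩ (openConn a y)ᶜ ∩ openConn a b ∩ (openConn c y)ᶜ) :=
    measureReal_nonneg
  have n3 : 0 ≤ (prodBernoulli w).real ((openConn a b)ᶜ ∩ (openConn a c)ᶜ ∩ openConn a y ∩ openConn b c) :=
    measureReal_nonneg
  have n4 : 0 ≤ (prodBernoulli w).real ((openConn a b)ᶜ ∩ (openConn a c)ᶜ ∩ (openConn a y)ᶜ ∩
      (openConn b y ∩ openConn c y)) := measureReal_nonneg
  have n5 : 0 ≤ (prodBernoulli w).real ((openConn a c)ᶜ ∩ (openConn b c)ᶜ ∩ (openConn y c)ᶜ ∩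
      ((openConn a b)ᶜ ∩ openConn a y)) := measureReal_nonneg
  have n6 : 0 ≤ (prodBernoulli w).real ((openConn a c)ᶜ ∩ (openConn b c)ᶜ ∩ (openConn y c)ᶜ ∩
      ((openConn a b)ᶜ ∩ (openConn a y)ᶜ ∩ (openConn b y)ᶜ)) := measureReal_nonneg
  nlinarith [h1, h2, mul_nonneg n4 n5, mul_nonneg (add_nonneg n1 n2) n3, mul_nonneg n3 n6]

end Q44bExchange

end Summit.CriticalPhenomena.PercolationContinuityZ3.Theorems
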